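import Literature.NumberTheory.EllipticCurves.IwasawaEulerCharRankZeroAssemblyProofs
import HarnessLib

/-!
# Route `AlignedTransportAtTwo`, crux C3′ `BSDOfMainConjectureRankOneAtTwo` (stmt-BirchSwinnertonDyer-23008), line `birth` v5:
# the POSITIVE-RANK `Γ`-Euler-characteristic ASSEMBLY (Perrin-Riou's descent lemma, algebraic half) — every `p`, every
# `ℤ_p`-extension, every number field

HONEST FRAMING (cell `bsd-f1-sign2`, WIDTH-5 attach seat `bsd-line-att-p4` g7 under the C3′ lead lineage `bsd-line-att-p1`;
`--supports stmt-BirchSwinnertonDyer-23008 --as helper`). BSD is NOT proved; C3′ is NOT closed; nothing is asserted. THEOREMS ONLY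
(no `def`, no named fact, no `sorry`).

CONTEXT. The one open stub of line `birth` v5 of C3′, `F1Sign2.SchneiderLeadingTermFormulaAtTwoSq`, is kernel-equivalent (att-p4 g6,
`…Theorems.AlignedTransportAtTwoEulerCharAtTwo`, p624996/p625448/p628023) to the VALUE of the `Γ`-Euler characteristic
`χ(Γ, Sel_{2^∞}(E/ℚ_∞)) = #coker φ_X/#ker φ_X` at `2`. The tree holds Greenberg's RANK-ZERO assembly of that value
(`IwasawaEulerCharRankZeroAssemblyProofs`: Thm. 4.1 modulo Lemmas 4.4/4.7: `f(0)·#(Sel_∞)_γ·#E[p^∞]^{Γ_K} = u·#Sel_{p^∞}(E/K)·#ker g₀`)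
but nothing in positive rank, which is the C3′ case (`r_an = 1`). This file supplies the positive-rank assembly.

WHAT IS PROVED (every prime `p`, every `ℤ_p`-extension `K_∞/K` of every number field, topological generator `γ`, Pontryagin-dual
datum `D` with `X = X(E/K_∞)` finitely generated `Λ`-torsion):
* §1 the `q`-calculus of a composable pair `A —f→ B —g→ C` of abelian groups as an UNCONDITIONAL identity of `Nat.card`s and
  indices, `#ker(g∘f)·[B : f(A)]·[C : g(B)] = #ker f·#ker g·[C : (g∘f)(A)]` (`natCard_ker_comp_mul_index_mul_index`, the alternating
  product along the ker–coker sequence), with the finiteness transfers;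
* §2 for ANY homomorphism `ι : M → Sel_{p^∞}(E/K_0)` with finite kernel and cokernel and the ONE composite map
  `θ = φ_{Sel} ∘ e ∘ s₀ ∘ ι : M → Sel_0 → Sel_∞^{Γ_K} ≅ Sel_∞^γ → (Sel_∞)_γ = H¹(Γ, Sel_{p^∞}(E/K_∞))` (`s₀` restriction = the tree's
  `sMap κ 0`; `e` any additive identification of the two invariants, canonically the identity on classes,
  `exists_invariantsZero_addEquiv`; `φ_{Sel}` = Coates–Schneider–Sujatha's map (30) = the tree's `selmerInftyEulerMap`): IF
  `E(K_∞)[p^∞]`, Greenberg's `ker g₀ = A₀/Sel₀` and `ker(φ_X : X[T] → X/TX)` are finite THEN `θ` has finite kernel and cokernel,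
  **`#ker θ·#coker ι·#(A₀/Sel₀)·#ker φ_X = #coker φ_X·#ker h₀·#coker θ·#ker ι`** (`finite_and_natCard_derivedMap`, Λ-free) and
  **`[T^{ord f}] f·#ker h₀·#coker θ·#ker ι = u·#ker θ·#coker ι·#(A₀/Sel₀)`**, `u ∈ ℤ_pˣ` (`coeff_charGenerator_mul_card_derivedMap`);
  conversely `coker θ` finite ⇒ `ker φ_X` finite (`finite_ker_bockstein_of_finite_coker_derivedMap`). Ingredients, all tree
  theorems: Greenberg's Lemma 4.3 exact count (`natCard_kerS_mul_natCard_kerG`), Pontryagin duality `#ker φ_X = #coker φ_{Sel}`,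
  `#coker φ_X = #ker φ_{Sel}` (`IwasawaEulerCharDualityProofs`), `[T^{ord f}] f·#ker φ_X ∼ #coker φ_X` (`IwasawaEulerCharProofs`).
  With `ι = 0 → Sel_0` (`rank 0`) §2 is literally the tree's rank-`0` assembly. The Kummer instance `ι = E(K) ⊗ ℚ_p/ℤ_p ↪ Sel`
  (cokernel `Ш(E/K)[p^∞]`) and the `p = 2` cell consequences are in the companion file `…EulerCharAtTwoAssemblyKummer`.

WHAT IS NOT PROVED (printed continuation, not in print at `p = 2` over `ℚ`): the VALUE `#ker θ/#coker θ` against `Reg_p/(log_p κ(γ))^r`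
(Perrin-Riou 1992 §3.4 / Schneider 1985 §§6–8: «algebraic height = Bockstein») and `#(A₀/Sel₀)·#E(K)(p) = #ker r₀·#(Sel_∞)_Γ`,
`#ker r₀ ∼ ∏c_v^{(p)}·∏_{v∣p}#Ẽ_v(k_v)(p)²` (Greenberg Lemmas 4.7, 4.4). A proof note: the carriers here (subgroups of continuous
`H¹` of quotients by `conj_γ − 1`) make instance unification expensive, whence the raised `maxHeartbeats` on three theorems and the
`obtain`-free style.

References: [GreenbergLNM1716] §4 Thm. 4.1, Lemmas 4.2–4.7 (pp. 102–108 of the held copy `book:coatesnd-arithmetic-theory-elliptic-curves`);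
[CoatesSchneiderSujatha2003] §3 (30)–(31) p. 199, p. 204 (Case 2); [PerrinRiou1992] §3.4; [Schneider1985].
bears_on: stmt-BirchSwinnertonDyer-23008 (helper; closes nothing), stmt-BirchSwinnertonDyer-22298 (attach seat's item; untouched).
-/

set_option autoImplicit false
-- the route's Theorems namespace repeats a component by design (summit = sub-problem, D-0017).
set_option linter.dupNamespace false

noncomputable section

open scoped Classical

universe u

namespace Summit.BirchSwinnertonDyer.BirchSwinnertonDyer.Theorems.AlignedTransportAtTwoEulerCharAtTwoAssembly

/-! ## §1 The `q`-calculus of a composable pair `A —f→ B —g→ C` (ker–coker sequence, as indices) -/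

section QCalculus

variable {A B C : Type*} [AddCommGroup A] [AddCommGroup B] [AddCommGroup C]
  (f : A →+ B) (g : B →+ C)

/-- `f((g ∘ f).ker) = f(A) ∩ ker g`. [folklore] -/
theorem map_ker_comp_eq_range_inf_ker : ((g.comp f).ker).map f = f.range ⊓ g.ker := by
  ext x
  simp only [AddSubgroup.mem_map, AddMonoidHom.mem_ker, AddMonoidHom.coe_comp, Function.comp_apply,
    AddSubgroup.mem_inf, AddMonoidHom.mem_range]
  constructor
  · rintro ⟨a, ha, rfl⟩
    exact ⟨⟨a, rfl⟩, ha⟩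
  · rintro ⟨⟨a, rfl⟩, hx⟩
    exact ⟨a, hx, rfl⟩

/-- `#ker(g ∘ f) = #ker f · #f(ker(g ∘ f))` (`ker f ≤ ker (g ∘ f)`, first isomorphism theorem for `f|`;
as `Nat.card`s, unconditionally). [folklore] -/
theorem natCard_ker_comp_eq :
    Nat.card (g.comp f).ker = Nat.card f.ker * Nat.card ↥(((g.comp f).ker).map f) := by
  have hle : f.ker ≤ (g.comp f).ker := fun a ha ↦ by
    rw [AddMonoidHom.mem_ker] at ha ⊢
    rw [AddMonoidHom.comp_apply, ha, map_zero]
  rw [← AddSubgroup.relIndex_ker, ← Nat.card_congr (AddSubgroup.addSubgroupOfEquivOfLe hle).toEquiv,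
    AddSubgroup.relIndex, AddSubgroup.card_mul_index]

/-- `#ker g = #f(ker(g ∘ f)) · [ker g : f(ker(g ∘ f))]` (`f(ker(g ∘ f)) = f(A) ∩ ker g ≤ ker g`;
unconditional). [folklore] -/
theorem natCard_ker_eq :
    Nat.card g.ker = Nat.card ↥(((g.comp f).ker).map f) * (((g.comp f).ker).map f).relIndex g.ker := by
  have hle : ((g.comp f).ker).map f ≤ g.ker := by
    rw [map_ker_comp_eq_range_inf_ker]; exact inf_le_right
  rw [← Nat.card_congr (AddSubgroup.addSubgroupOfEquivOfLe hle).toEquiv, AddSubgroup.relIndex,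
    AddSubgroup.card_mul_index]

/-- `[B : f(A)] = [ker g : f(A) ∩ ker g] · [B : f(A) + ker g]` (unconditional). [folklore] -/
theorem index_range_eq :
    f.range.index = (((g.comp f).ker).map f).relIndex g.ker * (f.range ⊔ g.ker).index := by
  rw [← AddSubgroup.relIndex_mul_index (le_sup_left : f.range ≤ f.range ⊔ g.ker),
    AddSubgroup.relIndex_sup_left, ← AddSubgroup.inf_relIndex_right, map_ker_comp_eq_range_inf_ker]

/-- `[C : g(f(A))] = [B : f(A) + ker g] · [C : g(B)]` (unconditional). [folklore] -/
theorem index_range_comp_eq :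
    (g.comp f).range.index = (f.range ⊔ g.ker).index * g.range.index := by
  rw [AddMonoidHom.range_comp, AddSubgroup.index_map]

/-- **The `q`-identity of a composable pair** (the alternating product of the orders in the exact
ker–coker sequence `0 → ker f → ker(g∘f) → ker g → coker f → coker(g∘f) → coker g → 0`), as an
UNCONDITIONAL identity of `Nat.card`s and indices (`0` for infinite):
`#ker(g∘f) · [B : f(A)] · [C : g(B)] = #ker f · #ker g · [C : (g∘f)(A)]`. So `q = #ker/#coker` is
multiplicative whenever the six groups are finite. [folklore] -/
theorem natCard_ker_comp_mul_index_mul_index :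
    Nat.card (g.comp f).ker * f.range.index * g.range.index =
      Nat.card f.ker * Nat.card g.ker * (g.comp f).range.index := by
  rw [natCard_ker_comp_eq f g, natCard_ker_eq f g, index_range_eq f g, index_range_comp_eq f g]
  ring

/-- Finiteness transfer along a composition, kernels: `ker f`, `ker g` finite ⇒ `ker(g∘f)` finite. [folklore] -/
theorem finite_ker_comp (hf : Finite f.ker) (hg : Finite g.ker) : Finite (g.comp f).ker := by
  have hle : ((g.comp f).ker).map f ≤ g.ker := by
    rw [map_ker_comp_eq_range_inf_ker]; exact inf_le_right
  haveI : Finite ↥(((g.comp f).ker).map f) := Finite.of_injective _ (AddSubgroup.inclusion_injective hle)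
  apply Nat.finite_of_card_ne_zero
  rw [natCard_ker_comp_eq f g]
  exact mul_ne_zero Nat.card_pos.ne' Nat.card_pos.ne'

/-- Finiteness transfer along a composition, cokernels: `coker f`, `coker g` finite ⇒ `coker(g∘f)`
finite. [folklore] -/
theorem finite_coker_comp (hf : Finite (B ⧸ f.range)) (hg : Finite (C ⧸ g.range)) :
    Finite (C ⧸ (g.comp f).range) := by
  have hf : f.range.index ≠ 0 := by rw [AddSubgroup.index_eq_card]; exact Nat.card_pos.ne'
  have hg : g.range.index ≠ 0 := by rw [AddSubgroup.index_eq_card]; exact Nat.card_pos.ne'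
  have hS : (f.range ⊔ g.ker).index ≠ 0 := fun h ↦ hf (by rw [index_range_eq f g, h, mul_zero])
  have h : (g.comp f).range.index ≠ 0 := by rw [index_range_comp_eq f g]; exact mul_ne_zero hS hg
  rw [AddSubgroup.index_eq_card] at h
  exact Nat.finite_of_card_ne_zero h

/-- `ker(g∘f)` finite ⇒ `ker f` finite (a subgroup). [folklore] -/
theorem finite_ker_of_finite_ker_comp (hgf : Finite (g.comp f).ker) : Finite f.ker := by
  have hle : f.ker ≤ (g.comp f).ker := fun a ha ↦ by
    rw [AddMonoidHom.mem_ker] at ha ⊢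
    rw [AddMonoidHom.comp_apply, ha, map_zero]
  exact Finite.of_injective _ (AddSubgroup.inclusion_injective hle)

/-- `coker(g∘f)` finite ⇒ `coker g` finite (a quotient). [folklore] -/
theorem finite_coker_of_finite_coker_comp (hgf : Finite (C ⧸ (g.comp f).range)) : Finite (C ⧸ g.range) := by
  have hle : (g.comp f).range ≤ g.range := by rw [AddMonoidHom.range_comp]; exact AddSubgroup.map_le_range _ _
  exact Finite.of_surjective _ (QuotientAddGroup.map_surjective_of_surjective _ _ (AddMonoidHom.id C)
    ((QuotientAddGroup.mk'_surjective _).comp Function.surjective_id)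
    (fun x hx ↦ AddSubgroup.mem_comap.mpr (hle hx)))

/-- `ker(g∘f)` and `coker f` finite ⇒ `ker g` finite (`#ker g = #f(ker(g∘f)) · [ker g : f(A) ∩ ker g]` and the
second factor divides `[B : f(A)]`). [folklore] -/
theorem finite_ker_of_finite_ker_comp_of_finite_coker (hgf : Finite (g.comp f).ker)
    (hf : Finite (B ⧸ f.range)) : Finite g.ker := by
  haveI := hgf; haveI := hf
  haveI : Finite ↥(((g.comp f).ker).map f) :=
    Finite.of_surjective (fun a : (g.comp f).ker ↦ (⟨f a, ⟨a, a.2, rfl⟩⟩ : ((g.comp f).ker).map f))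
      (by rintro ⟨_, a, ha, rfl⟩; exact ⟨⟨a, ha⟩, rfl⟩)
  have hf : f.range.index ≠ 0 := by rw [AddSubgroup.index_eq_card]; exact Nat.card_pos.ne'
  have hQ : (((g.comp f).ker).map f).relIndex g.ker ≠ 0 := fun h ↦ hf (by rw [index_range_eq f g, h, zero_mul])
  apply Nat.finite_of_card_ne_zero
  rw [natCard_ker_eq f g]
  exact mul_ne_zero Nat.card_pos.ne' hQ

/-- `#ker f ≠ 0` for a finite kernel (generic packaging: avoids instance search on deep carriers). [folklore] -/
theorem natCard_ker_ne_zero (hf : Finite f.ker) : Nat.card f.ker ≠ 0 := by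
  haveI := hf; exact Nat.card_pos.ne'

/-- `#coker f ≠ 0` for a finite cokernel (generic packaging). [folklore] -/
theorem natCard_coker_ne_zero (hf : Finite (B ⧸ f.range)) : Nat.card (B ⧸ f.range) ≠ 0 := by
  haveI := hf; exact Nat.card_pos.ne'

end QCalculus

/-! ## §2 The positive-rank assembly over any number field and any `ℤ_p`-extension -/

section Assembly

open Literature.NumberTheory.EllipticCurves Literature.NumberTheory.EllipticCurves.IwasawaAlgebra
  Literature.NumberTheory.EllipticCurves.IwasawaDual WeierstrassCurve

variable {K : Type u} [Field K] [NumberField K] (W : WeierstrassCurve K) {p : ℕ} [Fact p.Prime]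
  (κ : ZpExtension K p) {γ : Field.absoluteGaloisGroup K}

/-- **`Sel_∞^{Γ_K} ≃+ Sel_∞^γ` additively, the identity on underlying classes** (the tree's
`selmerInftyInfLayerInvariantsZeroEquiv`, which is stated as a bare `Equiv`, is additive): for a topological
generator `γ`, the level-`0` invariants of the control theorem and `H⁰(Γ, Sel_∞) = ker(conj_γ - 1)` of the
Euler-characteristic map are the same subgroup of `H¹(K_∞, E[p^∞])`. Greenberg, LNM 1716, §1 p. 60 and §3 p. 86.
[cite: GreenbergLNM1716, §1 p. 60] -/
theorem exists_invariantsZero_addEquiv (hγ : κ.IsTopGenerator γ) :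
    ∃ e : ↥(W.selmerInfty κ ⊓ W.layerInvariants κ 0) ≃+ ↥(endInvariants (W.conjSelmerInfty κ γ - 1)),
      ∀ x, (((e x : ↥(endInvariants (W.conjSelmerInfty κ γ - 1))) : W.selmerInfty κ) :
        W.subgroupH1 p κ.kerSubgroup) = (x : W.subgroupH1 p κ.kerSubgroup) :=
  ⟨{ W.selmerInftyInfLayerInvariantsZeroEquiv κ hγ with map_add' := fun _ _ ↦ rfl }, fun _ ↦ rfl⟩

/-- Pure arithmetic of the assembly: from the two `q`-identities and Greenberg's exact count, after cancelling
`#ker s₀ · #coker θ₀ ≠ 0`: `kθ·cι·kg·cφ = kφ·kh·cθ·kι`. [folklore] -/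
theorem assembly_arith {a b ks cs kφ cφ kh kg kθ cθ kι cι : ℕ} (hks : ks ≠ 0) (hb : b ≠ 0)
    (hq1 : a * cs * cφ = ks * kφ * b) (h43 : ks * kg = kh * cs) (hq2 : kθ * cι * b = kι * a * cθ) :
    kθ * cι * kg * cφ = kφ * kh * cθ * kι := by
  have key : kθ * cι * kg * cφ * (ks * b) = kφ * kh * cθ * kι * (ks * b) := by
    calc kθ * cι * kg * cφ * (ks * b) = (kθ * cι * b) * (ks * kg) * cφ := by ring
      _ = (kι * a * cθ) * (kh * cs) * cφ := by rw [hq2, h43]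
      _ = kι * cθ * kh * (a * cs * cφ) := by ring
      _ = kι * cθ * kh * (ks * kφ * b) := by rw [hq1]
      _ = kφ * kh * cθ * kι * (ks * b) := by ring
  exact Nat.eq_of_mul_eq_mul_right (Nat.pos_of_ne_zero (mul_ne_zero hks hb)) key

/-- `#ker(e ∘ s₀) = #(ker h₀ ⊓ Sel₀)` for any additive identification `e` of the invariants (`e` injective;
tree `natCard_ker_sMap`). [cite: GreenbergLNM1716, §4 Lemma 4.3] -/
theorem natCard_ker_equiv_comp_sMap
    (e : ↥(W.selmerInfty κ ⊓ W.layerInvariants κ 0) ≃+ ↥(endInvariants (W.conjSelmerInfty κ γ - 1))) :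
    Nat.card ((e : ↥(W.selmerInfty κ ⊓ W.layerInvariants κ 0) →+ ↥(endInvariants (W.conjSelmerInfty κ γ - 1))).comp (W.sMap κ 0)).ker = Nat.card ↥((W.layerToInfty κ 0).ker ⊓ W.selmerLayer κ 0) := by
  rw [← W.natCard_ker_sMap κ 0, ← AddMonoidHom.comap_ker, (AddMonoidHom.ker_eq_bot_iff _).mpr e.injective,
    AddMonoidHom.comap_bot]

/-- `[Sel_∞^γ : (e ∘ s₀)(Sel₀)] = #coker s₀` for any additive identification `e` of the invariants (tree
`range_sMap_eq`). [cite: GreenbergLNM1716, §4 Lemma 4.3] -/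
theorem index_range_equiv_comp_sMap
    (e : ↥(W.selmerInfty κ ⊓ W.layerInvariants κ 0) ≃+ ↥(endInvariants (W.conjSelmerInfty κ γ - 1))) :
    ((e : ↥(W.selmerInfty κ ⊓ W.layerInvariants κ 0) →+ ↥(endInvariants (W.conjSelmerInfty κ γ - 1))).comp (W.sMap κ 0)).range.index = Nat.card (W.CokerS κ 0) := by
  rw [AddMonoidHom.range_comp, AddSubgroup.index_map_equiv, W.range_sMap_eq κ 0, AddSubgroup.index_eq_card]

/-- Finiteness of `ker(e ∘ s₀)` (from `E(K_∞)[p^∞]` finite) and of `coker(e ∘ s₀)` (from `ker g₀` finite, Lemma 3.2).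
[cite: GreenbergLNM1716, §3 Lemmas 3.1–3.2, §4 Lemma 4.3] -/
theorem finite_ker_coker_equiv_comp_sMap [Finite (FixedPoints.addSubgroup κ.kerSubgroup (geomPrimaryTorsion W p))]
    [Finite (W.KerG κ 0)]
    (e : ↥(W.selmerInfty κ ⊓ W.layerInvariants κ 0) ≃+ ↥(endInvariants (W.conjSelmerInfty κ γ - 1))) :
    Finite ((e : ↥(W.selmerInfty κ ⊓ W.layerInvariants κ 0) →+ ↥(endInvariants (W.conjSelmerInfty κ γ - 1))).comp (W.sMap κ 0)).ker ∧
      Finite (↥(endInvariants (W.conjSelmerInfty κ γ - 1)) ⧸ ((e : ↥(W.selmerInfty κ ⊓ W.layerInvariants κ 0) →+ ↥(endInvariants (W.conjSelmerInfty κ γ - 1))).comp (W.sMap κ 0)).range) := by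
  -- `ker h₀` is finite: `#ker h₀ = #E[p^∞]^{Gal(K̄/K_0)} ≤ #E(K_∞)[p^∞]` (Greenberg Lemma 4.3 / tree
  -- `natCard_ker_layerToInfty_eq_natCard_fixedPoints`; cf. `Rank1Residual.X1.GeneratorCountTorsion.finite_ker_layerToInfty_zero`)
  haveI : Finite (W.layerToInfty κ 0).ker := by
    apply Nat.finite_of_card_ne_zero
    rw [W.natCard_ker_layerToInfty_eq_natCard_fixedPoints κ 0]
    haveI : Finite {m : geomPrimaryTorsion W p | ∀ σ ∈ κ.layerSubgroup 0, σ • m = m} := by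
      refine Finite.of_injective
        (fun m ↦ (⟨m.1, fun σ ↦ m.2 σ.1 (κ.kerSubgroup_le_layerSubgroup 0 σ.2)⟩ :
          FixedPoints.addSubgroup κ.kerSubgroup (geomPrimaryTorsion W p))) ?_
      intro m m' h
      simp only [Subtype.mk.injEq] at h
      exact Subtype.ext h
    haveI : Nonempty {m : geomPrimaryTorsion W p | ∀ σ ∈ κ.layerSubgroup 0, σ • m = m} :=
      ⟨⟨0, fun σ _ ↦ smul_zero σ⟩⟩
    exact Nat.card_pos.ne'
  haveI : Finite ↥((W.layerToInfty κ 0).ker ⊓ W.selmerLayer κ 0) :=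
    Finite.of_injective _ (AddSubgroup.inclusion_injective inf_le_left)
  haveI : Finite (W.CokerS κ 0) := Finite.of_surjective _ (W.kerGToCoker_surjective κ 0)
  constructor
  · apply Nat.finite_of_card_ne_zero
    rw [natCard_ker_equiv_comp_sMap W κ e]
    exact Nat.card_pos.ne'
  · apply Nat.finite_of_card_ne_zero
    rw [← AddSubgroup.index_eq_card, index_range_equiv_comp_sMap W κ e]
    exact Nat.card_pos.ne'

set_option maxHeartbeats 2000000 in
/-- **THE DESCENT COUNT (Λ-free half of the assembly; every `p`, every `ℤ_p`-extension, every number field).**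
With `θ = φ_{Sel} ∘ e ∘ s₀ ∘ ι : M → Sel_0 → Sel_∞^{Γ_K} ≅ Sel_∞^γ → (Sel_∞)_γ = H¹(Γ, Sel_{p^∞}(E/K_∞))` as in
`coeff_charGenerator_mul_card_derivedMap` (`ι` any homomorphism with finite kernel and cokernel, `e` any additive
identification of the invariants), `X = X(E/K_∞)` finitely generated `Λ`-torsion (dual datum `D`), `E(K_∞)[p^∞]` and
`ker g₀ = A₀/Sel₀` finite and `ker φ_X` finite: `θ` has finite kernel and cokernel and
**`#ker θ · #coker ι · #(A₀/Sel₀) · #ker φ_X = #coker φ_X · #ker h₀ · #coker θ · #ker ι`** (an identity of natural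
numbers). Ingredients: the `q`-identity (§1) along `e ∘ s₀` and `φ_{Sel}` and along `ι` and `φ_{Sel} ∘ e ∘ s₀`; Greenberg's
exact count `#ker s₀ · #(A₀/Sel₀) = #ker h₀ · #coker s₀` (Lemma 4.3, tree); Pontryagin duality `#ker φ_X = #coker φ_{Sel}`,
`#coker φ_X = #ker φ_{Sel}` (tree). No characteristic series, no height: pure descent bookkeeping.
[cite: GreenbergLNM1716, §4 Lemmas 4.2–4.3 (pp. 102–103)] [cite: CoatesSchneiderSujatha2003, §3 (30)–(31) p. 199] -/
theorem finite_and_natCard_derivedMap (hγ : κ.IsTopGenerator γ) (D : W.SelmerDualData κ γ)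
    [Module.Finite (IwasawaAlgebra p) D.X] (hX : Module.IsTorsion (IwasawaAlgebra p) D.X)
    [Finite (FixedPoints.addSubgroup κ.kerSubgroup (geomPrimaryTorsion W p))] [Finite (W.KerG κ 0)]
    (hfin : Finite (LinearMap.ker (bockstein p D.X)))
    (e : ↥(W.selmerInfty κ ⊓ W.layerInvariants κ 0) ≃+ ↥(endInvariants (W.conjSelmerInfty κ γ - 1)))
    {M : Type*} [AddCommGroup M] (ι : M →+ ↥(W.selmerLayer κ 0)) [Finite ι.ker]
    [Finite (↥(W.selmerLayer κ 0) ⧸ ι.range)]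
    (θ : M →+ EndCoinvariants (W.conjSelmerInfty κ γ - 1))
    (hθ : θ = (W.selmerInftyEulerMap κ γ).comp (((e : ↥(W.selmerInfty κ ⊓ W.layerInvariants κ 0) →+ ↥(endInvariants (W.conjSelmerInfty κ γ - 1))).comp (W.sMap κ 0)).comp ι)) :
    Finite θ.ker ∧ Finite (EndCoinvariants (W.conjSelmerInfty κ γ - 1) ⧸ θ.range) ∧
      Nat.card θ.ker * Nat.card (↥(W.selmerLayer κ 0) ⧸ ι.range) * Nat.card (W.KerG κ 0) *
          Nat.card (LinearMap.ker (bockstein p D.X)) =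
        Nat.card (coinvariants p D.X ⧸ LinearMap.range (bockstein p D.X)) * Nat.card (W.layerToInfty κ 0).ker *
          Nat.card (EndCoinvariants (W.conjSelmerInfty κ γ - 1) ⧸ θ.range) * Nat.card ι.ker := by
  -- names for the composite pieces (no `set`: it re-types hypotheses)
  obtain ⟨s, hs⟩ : ∃ s : ↥(W.selmerLayer κ 0) →+ ↥(endInvariants (W.conjSelmerInfty κ γ - 1)),
      s = (e : ↥(W.selmerInfty κ ⊓ W.layerInvariants κ 0) →+ ↥(endInvariants (W.conjSelmerInfty κ γ - 1))).comp (W.sMap κ 0) := ⟨_, rfl⟩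
  obtain ⟨θ₀, hθ₀⟩ : ∃ θ₀ : ↥(W.selmerLayer κ 0) →+ EndCoinvariants (W.conjSelmerInfty κ γ - 1),
      θ₀ = (W.selmerInftyEulerMap κ γ).comp s := ⟨_, rfl⟩
  have hθ' : θ = θ₀.comp ι := by
    rw [hθ₀, hs, hθ]
    rfl
  -- finiteness of the pieces
  have hsc := finite_ker_coker_equiv_comp_sMap (γ := γ) W κ e
  rw [← hs] at hsc
  have hcφfin : Finite (EndCoinvariants (W.conjSelmerInfty κ γ - 1) ⧸ (W.selmerInftyEulerMap κ γ).range) :=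
    (D.finite_ker_bockstein_iff W hγ).mp hfin
  have hkφfin : Finite (W.selmerInftyEulerMap κ γ).ker :=
    (D.finite_coker_bockstein_iff W hγ).mp
      ((finite_ker_bockstein_iff_finite_coker_bockstein p D.X hX).mp hfin)
  have hafin : Finite θ₀.ker := by
    have h := finite_ker_comp s (W.selmerInftyEulerMap κ γ) hsc.1 hkφfin
    rwa [← hθ₀] at h
  have hbfin : Finite (EndCoinvariants (W.conjSelmerInfty κ γ - 1) ⧸ θ₀.range) := by
    have h := finite_coker_comp s (W.selmerInftyEulerMap κ γ) hsc.2 hcφfin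
    rwa [← hθ₀] at h
  have hkθfin : Finite θ.ker := by
    have h := finite_ker_comp ι θ₀ ‹_› hafin
    rwa [← hθ'] at h
  have hcθfin : Finite (EndCoinvariants (W.conjSelmerInfty κ γ - 1) ⧸ θ.range) := by
    have h := finite_coker_comp ι θ₀ ‹_› hbfin
    rwa [← hθ'] at h
  refine ⟨hkθfin, hcθfin, ?_⟩
  -- the arithmetic: two `q`-identities and Greenberg's count
  have hq1 := natCard_ker_comp_mul_index_mul_index s (W.selmerInftyEulerMap κ γ)
  rw [← hθ₀, hs, natCard_ker_equiv_comp_sMap W κ e, index_range_equiv_comp_sMap W κ e,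
    AddSubgroup.index_eq_card, AddSubgroup.index_eq_card] at hq1
  have hq2 := natCard_ker_comp_mul_index_mul_index ι θ₀
  rw [← hθ', AddSubgroup.index_eq_card, AddSubgroup.index_eq_card] at hq2
  have hks0 : Nat.card ↥((W.layerToInfty κ 0).ker ⊓ W.selmerLayer κ 0) ≠ 0 := by
    rw [← natCard_ker_equiv_comp_sMap W κ e, ← hs]; exact natCard_ker_ne_zero s hsc.1
  have hN := assembly_arith hks0 (natCard_coker_ne_zero θ₀ hbfin) hq1 (W.natCard_kerS_mul_natCard_kerG κ 0) hq2
  rw [D.natCard_ker_bockstein W hγ, D.natCard_coker_bockstein W hγ]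
  exact hN

set_option maxHeartbeats 2000000 in
/-- **THE POSITIVE-RANK `Γ`-EULER-CHARACTERISTIC ASSEMBLY (Perrin-Riou's descent lemma, algebraic half; every
`p`, every `ℤ_p`-extension, every number field).** Let `E/K` be elliptic, `K_∞/K` a `ℤ_p`-extension with
topological generator `γ`, `D` a Pontryagin-dual datum with `X = X(E/K_∞)` finitely generated `Λ`-torsion and
`char(X) = (f)`, and let `ι : M → Sel_{p^∞}(E/K_0)` be any homomorphism with finite kernel and cokernel (the
Kummer map `E(K) ⊗ ℚ_p/ℤ_p ↪ Sel_{p^∞}(E/K)`, cokernel `Ш(E/K)[p^∞]`, is the case of interest, §3). Form the ONE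
composite map
`θ = φ_{Sel} ∘ e ∘ s₀ ∘ ι : M → Sel_0 → Sel_∞^{Γ_K} ≅ Sel_∞^γ → (Sel_∞)_γ = H¹(Γ, Sel_{p^∞}(E/K_∞))`
(`s₀` restriction, `e` ANY additive identification of the two invariants — the canonical one is the identity on
classes, `exists_invariantsZero_addEquiv` — and `φ_{Sel}` = CSS's map (30)). Assume `E(K_∞)[p^∞]` finite,
Greenberg's `ker g₀ = A₀/Sel₀` finite, and `ker(φ_X : X[T] → X/TX)` finite (i.e. `ord_T f = rank_{ℤ_p} X/TX`).
THEN `θ` has finite kernel and cokernel and, for a unit `u ∈ ℤ_pˣ`,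
**`[T^{ord f}] f · #ker h₀ · #coker θ · #ker ι = u · #ker θ · #coker ι · #(A₀/Sel₀)`**
(`finite_and_natCard_derivedMap` and the tree's `[T^{ord f}] f · #ker φ_X = u · #coker φ_X`,
`coeff_order_charGenerator_mul_card_ker_bockstein`). Its rank-`0` instance (`M = 0`) is the tree's
`constantCoeff_charGenerator_mul_natCard_coinvariants_mul_natCard_fixedPoints` (Greenberg Thm. 4.1 modulo Lemmas
4.4/4.7). Printed continuation NOT formalised: `#ker θ/#coker θ` = the `|det(h_p/log_p κ(γ))|_p^{-1}`-part (Perrin-Riou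
1992 §3.4 / Schneider 1985 §§6–8: «algebraic height = Bockstein») and `#(A₀/Sel₀)·#E(K)(p) = #ker r₀·#(Sel_∞)_Γ`,
`#ker r₀ ∼ ∏ c_v^{(p)}·∏_{v∣p} #Ẽ_v(k_v)(p)²` (Greenberg Lemmas 4.7, 4.4).
[cite: GreenbergLNM1716, §4 Thm. 4.1, Lemmas 4.2–4.3 (pp. 102–103), Lemmas 4.4–4.7 (pp. 104–108)]
[cite: CoatesSchneiderSujatha2003, §3 (30)–(31) p. 199, p. 204 (Case 2)] [cite: PerrinRiou1992, §3.4] -/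
theorem coeff_charGenerator_mul_card_derivedMap (hγ : κ.IsTopGenerator γ) (D : W.SelmerDualData κ γ)
    [Module.Finite (IwasawaAlgebra p) D.X] (hX : Module.IsTorsion (IwasawaAlgebra p) D.X)
    (f : IwasawaAlgebra p) (hf : Module.charIdeal (IwasawaAlgebra p) D.X = Ideal.span {f})
    [Finite (FixedPoints.addSubgroup κ.kerSubgroup (geomPrimaryTorsion W p))] [Finite (W.KerG κ 0)]
    (hfin : Finite (LinearMap.ker (bockstein p D.X)))
    (e : ↥(W.selmerInfty κ ⊓ W.layerInvariants κ 0) ≃+ ↥(endInvariants (W.conjSelmerInfty κ γ - 1)))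
    {M : Type*} [AddCommGroup M] (ι : M →+ ↥(W.selmerLayer κ 0)) [Finite ι.ker]
    [Finite (↥(W.selmerLayer κ 0) ⧸ ι.range)]
    (θ : M →+ EndCoinvariants (W.conjSelmerInfty κ γ - 1))
    (hθ : θ = (W.selmerInftyEulerMap κ γ).comp (((e : ↥(W.selmerInfty κ ⊓ W.layerInvariants κ 0) →+ ↥(endInvariants (W.conjSelmerInfty κ γ - 1))).comp (W.sMap κ 0)).comp ι)) :
    Finite θ.ker ∧ Finite (EndCoinvariants (W.conjSelmerInfty κ γ - 1) ⧸ θ.range) ∧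
      ∃ u : ℤ_[p]ˣ,
        PowerSeries.coeff f.order.toNat f * (Nat.card (W.layerToInfty κ 0).ker : ℤ_[p]) *
            Nat.card (EndCoinvariants (W.conjSelmerInfty κ γ - 1) ⧸ θ.range) * Nat.card ι.ker =
          u * Nat.card θ.ker * Nat.card (↥(W.selmerLayer κ 0) ⧸ ι.range) * Nat.card (W.KerG κ 0) := by
  have h := finite_and_natCard_derivedMap W κ hγ D hX hfin e ι θ hθ
  refine ⟨h.1, h.2.1, ?_⟩
  have hΛ := coeff_order_charGenerator_mul_card_ker_bockstein p D.X hX f hf hfin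
  refine Exists.imp (fun u hu ↦ ?_) hΛ
  haveI := hfin
  have ha0 : (Nat.card (LinearMap.ker (bockstein p D.X)) : ℤ_[p]) ≠ 0 := by exact_mod_cast Nat.card_pos.ne'
  refine mul_right_cancel₀ ha0 ?_
  have hN : ((Nat.card θ.ker : ℕ) : ℤ_[p]) * Nat.card (↥(W.selmerLayer κ 0) ⧸ ι.range) * Nat.card (W.KerG κ 0) *
      Nat.card (LinearMap.ker (bockstein p D.X)) =
      (Nat.card (coinvariants p D.X ⧸ LinearMap.range (bockstein p D.X)) : ℤ_[p]) * Nat.card (W.layerToInfty κ 0).ker *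
      Nat.card (EndCoinvariants (W.conjSelmerInfty κ γ - 1) ⧸ θ.range) * Nat.card ι.ker := by
    exact_mod_cast h.2.2
  linear_combination ((Nat.card (W.layerToInfty κ 0).ker : ℤ_[p]) *
      Nat.card (EndCoinvariants (W.conjSelmerInfty κ γ - 1) ⧸ θ.range) * Nat.card ι.ker) * hu - (u : ℤ_[p]) * hN

/-- **Converse finiteness: if `coker θ` is finite then `ker φ_X` is finite** (so `ord_T f = rank_{ℤ_p} X/TX` by the
tree's criterion): `coker(φ_{Sel} ∘ (e ∘ s₀ ∘ ι))` finite ⇒ `coker φ_{Sel}` finite (§1) ⇒ `ker φ_X` finite (Pontryagin,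
tree `SelmerDualData.finite_ker_bockstein_iff`). No hypothesis on `ι`, `X` or `E(K_∞)[p^∞]`.
[cite: CoatesSchneiderSujatha2003, §3 (30)–(31) p. 199] -/
theorem finite_ker_bockstein_of_finite_coker_derivedMap (hγ : κ.IsTopGenerator γ) (D : W.SelmerDualData κ γ)
    (e : ↥(W.selmerInfty κ ⊓ W.layerInvariants κ 0) ≃+ ↥(endInvariants (W.conjSelmerInfty κ γ - 1)))
    {M : Type*} [AddCommGroup M] (ι : M →+ ↥(W.selmerLayer κ 0))
    (θ : M →+ EndCoinvariants (W.conjSelmerInfty κ γ - 1))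
    (hθ : θ = (W.selmerInftyEulerMap κ γ).comp (((e : ↥(W.selmerInfty κ ⊓ W.layerInvariants κ 0) →+ ↥(endInvariants (W.conjSelmerInfty κ γ - 1))).comp (W.sMap κ 0)).comp ι))
    (hcθ : Finite (EndCoinvariants (W.conjSelmerInfty κ γ - 1) ⧸ θ.range)) :
    Finite (LinearMap.ker (bockstein p D.X)) := by
  rw [D.finite_ker_bockstein_iff W hγ]
  rw [hθ] at hcθ
  exact finite_coker_of_finite_coker_comp (((e : ↥(W.selmerInfty κ ⊓ W.layerInvariants κ 0) →+ ↥(endInvariants (W.conjSelmerInfty κ γ - 1))).comp (W.sMap κ 0)).comp ι) (W.selmerInftyEulerMap κ γ) hcθ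

end Assembly

end Summit.BirchSwinnertonDyer.BirchSwinnertonDyer.Theorems.AlignedTransportAtTwoEulerCharAtTwoAssembly

end
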